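import Mathlib.Tactic.Ring
import Mathlib.Tactic.Linarith
import Mathlib.Data.Real.Basic
import HarnessLib

/-!
# Conjecture N (hodge-weil ladder, GAPS G51b), format (4,2): the VERTEX GAUGE — `Q₂`, `Q₄`, (P1), (P2) in heights over a level

Prover 2, generation 12 (note `run/shared/lean/b2b/hodge-weil/b2b-hweil-pv2-g12/VERTEX-FORM-G12.md` §2.3 and ADDENDUM 2). Companion of
`WeilClassTestVertexForm42.lean` (the bilinear vertex form `G₀ = 2Σ H_kl q_k p_l`) and `WeilClassTestSignLaw.lean`. Setting (`CONJECTURE-N.md` §1,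
format (4,2), real charges): E-roots `1..4`, F-roots `5,6`, positions `y_k`, charges `u_k`; mass-2 signed means `yb, ub`; centred `Y = y − yb`,
`Z = u − ub`; `S = ΣεZ²` (`S_u`), `v_k = Z_k² − S/2` (half the wall function), `Q₂ = ½S_yS + S_{yZ}² − 3S_{y²Z²}`, `Q₄ = 3ΣεZ⁴ − (3/2)S²`,
(P1) `= ΣεY²Z`, (P2) `= ΣεYZ²`. THE VERTEX GAUGE: fix any level `yV` and put `s_k = ε_k(y_k − yV)` (heights; all `≥ 0` iff `yV` separates F from E),
`A = Σ_k s_k`, `B = Σ_k s_kZ_k`. Identities (all `ring`, no hypothesis):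
* `Q4_eq` : `Q₄ = 3Σ_kε_kv_k²` (only `Σε = 2` is used);
* `P1_vertex_gauge` : `(P1) = Σ_kε_ks_k²Z_k − A·B` (so (P1) ⟺ `Σ_{k<l}(Z_k+Z_l)s_ks_l + 2Σ_F Z_fs_f² = 0`);
* `Q2_vertex_gauge` : `Q₂ = 3(Σ_k s_kv_k)·A + ½S·A² + B² − Σ_kε_k(3v_k + S)s_k²`; since `Σ_k s_kv_k = (P2)` in this gauge
  (`WeilClassTestWallFactorisation.format42_P2_vertex_identity`), ON THE PURE LOCUS
  `G₀ = ½S·A² + B² − Σ_kε_k(3v_k + S)s_k² + 3Σ_kε_kv_k²` — Conjecture N in format (4,2) is the non-negativity of this quartic on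
  `{s_k ≥ |Z_k + w|} ∩ (P1) ∩ (P2)`.
Pure algebra; nothing here is a rung, a door edge or a cited fact; no statement of Markman's papers is used. New cell result ⇒ Summits/.
-/

set_option linter.dupNamespace false

namespace Summit.HodgeConjecture.HodgeConjecture.WeilClassTestVertexGauge

/-- `Q₄ = 3Σ_k ε_k v_k²` with `v_k = Z_k² − S/2` (format (4,2); an identity — only `Σε = 2` enters). -/
theorem Q4_eq (u₁ u₂ u₃ u₄ u₅ u₆ : ℝ) :
    let ub : ℝ := (u₁ + u₂ + u₃ + u₄ - u₅ - u₆) / 2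
    let Z₁ : ℝ := u₁ - ub
    let Z₂ : ℝ := u₂ - ub
    let Z₃ : ℝ := u₃ - ub
    let Z₄ : ℝ := u₄ - ub
    let Z₅ : ℝ := u₅ - ub
    let Z₆ : ℝ := u₆ - ub
    let S : ℝ := Z₁ ^ 2 + Z₂ ^ 2 + Z₃ ^ 2 + Z₄ ^ 2 - (Z₅ ^ 2 + Z₆ ^ 2)
    3 * (Z₁ ^ 4 + Z₂ ^ 4 + Z₃ ^ 4 + Z₄ ^ 4 - (Z₅ ^ 4 + Z₆ ^ 4)) - 3 / 2 * S ^ 2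
      = 3 * ((Z₁ ^ 2 - S / 2) ^ 2 + (Z₂ ^ 2 - S / 2) ^ 2 + (Z₃ ^ 2 - S / 2) ^ 2 + (Z₄ ^ 2 - S / 2) ^ 2
          - ((Z₅ ^ 2 - S / 2) ^ 2 + (Z₆ ^ 2 - S / 2) ^ 2)) := by
  intro ub Z₁ Z₂ Z₃ Z₄ Z₅ Z₆ S
  simp only [S]
  ring

/-- (P1) in the vertex gauge: `ΣεY²Z = Σ_kε_ks_k²Z_k − A·B` for any level `yV` (identity). -/
theorem P1_vertex_gauge (y₁ y₂ y₃ y₄ y₅ y₆ u₁ u₂ u₃ u₄ u₅ u₆ yV : ℝ) :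
    let yb : ℝ := (y₁ + y₂ + y₃ + y₄ - y₅ - y₆) / 2
    let ub : ℝ := (u₁ + u₂ + u₃ + u₄ - u₅ - u₆) / 2
    let P1 : ℝ := (y₁ - yb) ^ 2 * (u₁ - ub) + (y₂ - yb) ^ 2 * (u₂ - ub) + (y₃ - yb) ^ 2 * (u₃ - ub)
      + (y₄ - yb) ^ 2 * (u₄ - ub) - ((y₅ - yb) ^ 2 * (u₅ - ub) + (y₆ - yb) ^ 2 * (u₆ - ub))
    let A : ℝ := (y₁ - yV) + (y₂ - yV) + (y₃ - yV) + (y₄ - yV) + (yV - y₅) + (yV - y₆)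
    let B : ℝ := (y₁ - yV) * (u₁ - ub) + (y₂ - yV) * (u₂ - ub) + (y₃ - yV) * (u₃ - ub) + (y₄ - yV) * (u₄ - ub)
      + (yV - y₅) * (u₅ - ub) + (yV - y₆) * (u₆ - ub)
    P1 = (y₁ - yV) ^ 2 * (u₁ - ub) + (y₂ - yV) ^ 2 * (u₂ - ub) + (y₃ - yV) ^ 2 * (u₃ - ub) + (y₄ - yV) ^ 2 * (u₄ - ub)
          - ((yV - y₅) ^ 2 * (u₅ - ub) + (yV - y₆) ^ 2 * (u₆ - ub)) - A * B := by
  intro yb ub P1 A B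
  simp only [B, A, P1, ub, yb]
  ring

/-- `Q₂` in the vertex gauge: `Q₂ = 3(Σ_k s_kv_k)·A + ½S·A² + B² − Σ_kε_k(3v_k + S)s_k²` for any level `yV` (identity); on the pure locus the
first term vanishes because `Σ_k s_kv_k = (P2)` in this gauge. -/
theorem Q2_vertex_gauge (y₁ y₂ y₃ y₄ y₅ y₆ u₁ u₂ u₃ u₄ u₅ u₆ yV : ℝ) :
    let yb : ℝ := (y₁ + y₂ + y₃ + y₄ - y₅ - y₆) / 2
    let ub : ℝ := (u₁ + u₂ + u₃ + u₄ - u₅ - u₆) / 2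
    let Z₁ : ℝ := u₁ - ub
    let Z₂ : ℝ := u₂ - ub
    let Z₃ : ℝ := u₃ - ub
    let Z₄ : ℝ := u₄ - ub
    let Z₅ : ℝ := u₅ - ub
    let Z₆ : ℝ := u₆ - ub
    let S : ℝ := Z₁ ^ 2 + Z₂ ^ 2 + Z₃ ^ 2 + Z₄ ^ 2 - (Z₅ ^ 2 + Z₆ ^ 2)
    let Sy : ℝ := (y₁ - yb) ^ 2 + (y₂ - yb) ^ 2 + (y₃ - yb) ^ 2 + (y₄ - yb) ^ 2 - ((y₅ - yb) ^ 2 + (y₆ - yb) ^ 2)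
    let Syz : ℝ := (y₁ - yb) * Z₁ + (y₂ - yb) * Z₂ + (y₃ - yb) * Z₃ + (y₄ - yb) * Z₄ - ((y₅ - yb) * Z₅ + (y₆ - yb) * Z₆)
    let Sy2z2 : ℝ := (y₁ - yb) ^ 2 * Z₁ ^ 2 + (y₂ - yb) ^ 2 * Z₂ ^ 2 + (y₃ - yb) ^ 2 * Z₃ ^ 2 + (y₄ - yb) ^ 2 * Z₄ ^ 2
      - ((y₅ - yb) ^ 2 * Z₅ ^ 2 + (y₆ - yb) ^ 2 * Z₆ ^ 2)
    let s₁ : ℝ := y₁ - yV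
    let s₂ : ℝ := y₂ - yV
    let s₃ : ℝ := y₃ - yV
    let s₄ : ℝ := y₄ - yV
    let s₅ : ℝ := yV - y₅
    let s₆ : ℝ := yV - y₆
    let A : ℝ := s₁ + s₂ + s₃ + s₄ + s₅ + s₆
    let B : ℝ := s₁ * Z₁ + s₂ * Z₂ + s₃ * Z₃ + s₄ * Z₄ + s₅ * Z₅ + s₆ * Z₆
    let sv : ℝ := s₁ * (Z₁ ^ 2 - S / 2) + s₂ * (Z₂ ^ 2 - S / 2) + s₃ * (Z₃ ^ 2 - S / 2) + s₄ * (Z₄ ^ 2 - S / 2)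
      + s₅ * (Z₅ ^ 2 - S / 2) + s₆ * (Z₆ ^ 2 - S / 2)
    1 / 2 * Sy * S + Syz ^ 2 - 3 * Sy2z2
      = 3 * sv * A + 1 / 2 * S * A ^ 2 + B ^ 2
        - ((3 * (Z₁ ^ 2 - S / 2) + S) * s₁ ^ 2 + (3 * (Z₂ ^ 2 - S / 2) + S) * s₂ ^ 2 + (3 * (Z₃ ^ 2 - S / 2) + S) * s₃ ^ 2
            + (3 * (Z₄ ^ 2 - S / 2) + S) * s₄ ^ 2 - ((3 * (Z₅ ^ 2 - S / 2) + S) * s₅ ^ 2 + (3 * (Z₆ ^ 2 - S / 2) + S) * s₆ ^ 2)) := by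
  intro yb ub Z₁ Z₂ Z₃ Z₄ Z₅ Z₆ S Sy Syz Sy2z2 s₁ s₂ s₃ s₄ s₅ s₆ A B sv
  simp only [sv, B, A, s₆, s₅, s₄, s₃, s₂, s₁, Sy2z2, Syz, Sy, S, Z₆, Z₅, Z₄, Z₃, Z₂, Z₁, ub, yb]
  ring

end Summit.HodgeConjecture.HodgeConjecture.WeilClassTestVertexGauge
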